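import Summits.NavierStokesRegularity.FluidComputer.GateBudget
import HarnessLib

/-!
# What no tuning can beat, part 62: THE θ-LEDGER AND THE P-LEDGER OF ONE RUNG — law 5″ of the
# θ-drift audit (SPEC-INPUT-bp1 §AZ(4)/§BB(2)), pure real arithmetic: the conclusions of the
# two-sided relight law (part 60 `knob_relight`) force the re-armed clock ratio
# `θ⁺ = b(r)/ε` to satisfy `θ⁺ ≤ θ + 529/K⁹`, `θ⁺² ≤ 2(1 - P₀) + 42/K⁹`, and
# `θ⁺ ≥ θ - 43/K⁹ ∨ θ⁺² ≥ 2(1 - P₀) - 65/K⁹` — NEUTRAL-OR-CLIPPING up to `O(K⁻⁹)` — hence, with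
# the pulse law 2′ (part 61: `|θ' - θₙ| ≤ 243/K⁹`), the window step
# `θₙ₊₁ ∈ [min(θₙ - 286/K⁹, 1.39999), 1.41422]`; and the output pair steps by
# `P ↦ P + 0.3η + 6/K⁹` per rung

Cell `pub-fluidc`, blueprint seat bp1 (gen 35, fifth item); same namespace and conventions as
parts 1–61 (`GateBudget*.lean`); imports ONLY part 1 (`GateBudget`) — no dynamics: every
statement below is an inequality between real numbers, to be instantiated by the ladder theorem
(20′d′) with part 60's relight data (`T` dousing time, `tz` clock zero, `r` relight time,
`θ⁺ε = b(r)`) and part 52 §154's pair step. `s_l := 1 - P₀ - 8/K⁹`, `s_u := 1 - P₀ + 6/K⁹` are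
part 57's carrier slopes. HONEST FRAMING (verbatim): low prior, high value-of-information
experiment on Tao's machine paradigm; NOT a claim that NS blows up. Nothing is proved about
the Navier–Stokes equations.

## Why (SPEC-INPUT-bp1 §BB(2))

Part 60 `knob_relight` returns, after a dousing at clock `-θε` with pair `P₀ ≤ 1/50` and
trigger floor `(ρ²/K⁹)e^{-L}`: the clock zero `tz ∈ [T + θ/s_u, T + θ/s_l]`, the relight time
`r > tz` with LOWER `T + 2θ/s_u < r ∨ 1 - 10 log K/K¹⁰ < s_u(r - tz)²/2`, UPPER
`r ≤ T + 2θ/s_l + L/(K¹⁰θ) ∧ s_l(r - tz)²/2 < 1`, and the re-armed clock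
`εs_l(r - tz) ≤ b(r) ≤ εs_u(r - tz)`. Eliminating `r - tz`: UPPER ⇒ `θ⁺ ≤ s_u(r - tz) ≤
θ(2s_u/s_l - 1) + s_uL/(K¹⁰θ) ≤ θ + 43/K⁹ + 486/K⁹` (`L ≤ 485K`, `θ ≥ 1`) and
`θ⁺² ≤ s_u²(r - tz)² < 2s_u²/s_l ≤ 2(1 - P₀) + 42/K⁹`; LOWER ⇒ `θ⁺ ≥ s_l(r - tz) >
θ(2s_l/s_u - 1) ≥ θ - 43/K⁹` or `θ⁺² ≥ s_l²(r - tz)² > (2s_l²/s_u)(1 - 10 log K/K¹⁰) ≥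
2(1 - P₀) - 65/K⁹` (`log K ≤ K`). The debt branch is neutral, the seed branch clips to
`√(2(1 - P₀)) ∈ [1.4, 1.41422]`; either way the window `[5/4, 1.41422]` is re-entered with a loss
of at most `286/K⁹` below — summable over `≍ 10⁻⁴K⁹` rungs.

## What is proved

* §191 `ledger_slopes`: `K ≥ 16`, `0 ≤ P₀ ≤ 1/50` ⇒ `0.97999 ≤ s_l`, `s_l + 14/K⁹ = s_u`,
  `0.98 ≤ s_u ≤ 1.00001`, `14/K⁹ ≤ 10⁻⁹`, `log K ≤ K`, `0 ≤ 1 - 10 log K/K¹⁰`.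
* §192 `theta_ledger_upper`: with `1 ≤ θ ≤ 3/2`, `0 ≤ L ≤ 485K`, `T + θ/s_u ≤ tz < r`,
  `r ≤ T + 2θ/s_l + L/(K¹⁰θ)`, `s_l(r - tz)²/2 < 1`, `x ≤ s_u(r - tz)`, `0 ≤ x`:
  `x ≤ θ + 529/K⁹` and `x² ≤ 2(1 - P₀) + 42/K⁹`.
* §193 `theta_ledger_lower`: with `θ ≤ 3/2`, `tz ≤ T + θ/s_l`, `tz < r`,
  `T + 2θ/s_u < r ∨ 1 - 10 log K/K¹⁰ < s_u(r - tz)²/2`, `s_l(r - tz) ≤ x`: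
  `θ - 43/K⁹ ≤ x ∨ 2(1 - P₀) - 65/K⁹ ≤ x²` (and `0 < x`).
* §194 `theta_window_step`: `K ≥ 16`, `0 ≤ P₀ ≤ 1/50`, `|θ' - θₙ| ≤ 243/K⁹` (law 2′), and the
  conclusions of §192/§193 for `θ = θ'` ⇒ `x ≤ 1.41422` and `θₙ - 286/K⁹ ≤ x ∨ 1.39999 ≤ x`.
* §195 `pair_ledger_step`: `0 ≤ P ≤ 1/50`, `0 ≤ η ≤ 0.0171`, `0 ≤ P'`, `√P' ≤ √P + η`,
  `|P'' - P'| ≤ 6/K⁹` ⇒ `P'' ≤ P + 3η/10 + 6/K⁹` (part 52 §154's `√P` step made linear).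

HONEST LIMITS. (i) Constants rounded up generously (`529`, `42`, `43`, `65`, `286`); (ii) the
file knows nothing about trajectories — it is the bookkeeping that (20′d′) will apply once per
rung; (iii) nothing about Navier–Stokes.
[cite: Tao2016AveragedNS, §5.5 Theorem 5.3, (5.5), (5.6)]
-/

noncomputable section

namespace Summit.NavierStokesRegularity.FluidComputer.GateBudget

open Real Set

/-! ## §191 The slopes -/

/-- §191 THE CARRIER SLOPES of part 57 as numbers: `K ≥ 16`, `0 ≤ P₀ ≤ 1/50` ⇒
`0.97999 ≤ s_l`, `s_u = s_l + 14/K⁹`, `0.98 ≤ s_u ≤ 1.00001`, `14/K⁹ ≤ 10⁻⁹`, `log K ≤ K`,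
`0 ≤ 1 - 10 log K/K¹⁰ ≤ 1`. [derived: this file §191] -/
theorem ledger_slopes {K P₀ : ℝ} (hK : 16 ≤ K) (hP0 : 0 ≤ P₀) (hP : P₀ ≤ 1 / 50) :
    97999 / 100000 ≤ 1 - P₀ - 8 / K ^ 9 ∧ 1 - P₀ + 6 / K ^ 9 = 1 - P₀ - 8 / K ^ 9 + 14 / K ^ 9 ∧
      98 / 100 ≤ 1 - P₀ + 6 / K ^ 9 ∧ 1 - P₀ + 6 / K ^ 9 ≤ 100001 / 100000 ∧
      14 / K ^ 9 ≤ 1 / 10 ^ 9 ∧ log K ≤ K ∧ 0 ≤ 1 - 10 * log K / K ^ 10 ∧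
      1 - 10 * log K / K ^ 10 ≤ 1 := by
  have hK0 : (0 : ℝ) < K := by linarith
  have hK9 : (16 : ℝ) ^ 9 ≤ K ^ 9 := pow_le_pow_left₀ (by norm_num) hK 9
  have hK9' : (0 : ℝ) < K ^ 9 := by positivity
  have h14 : 14 / K ^ 9 ≤ 1 / 10 ^ 9 := by
    rw [div_le_div_iff₀ hK9' (by norm_num)]; nlinarith only [hK9]
  have h8 : (0 : ℝ) ≤ 8 / K ^ 9 := by positivity
  have h6 : (0 : ℝ) ≤ 6 / K ^ 9 := by positivity
  have hlog : log K ≤ K := by linarith only [Real.log_le_sub_one_of_pos hK0]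
  have hlog0 : 0 ≤ log K := Real.log_nonneg (by linarith)
  have hK10 : (0 : ℝ) < K ^ 10 := by positivity
  have hfrac : 10 * log K / K ^ 10 ≤ 1 := by
    rw [div_le_one hK10]
    have : (16 : ℝ) ^ 9 * K ≤ K ^ 10 := by
      calc (16 : ℝ) ^ 9 * K ≤ K ^ 9 * K := mul_le_mul_of_nonneg_right hK9 hK0.le
        _ = K ^ 10 := by ring
    nlinarith only [hlog, this, hK0]
  have hfrac0 : 0 ≤ 10 * log K / K ^ 10 := by positivity
  refine ⟨?_, by ring, by linarith only [hP, h6], ?_, h14, hlog, by linarith only [hfrac],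
    by linarith only [hfrac0]⟩
  · have : 8 / K ^ 9 ≤ (1 : ℝ) / 10 ^ 9 := by
      rw [div_le_div_iff₀ hK9' (by norm_num)]; nlinarith only [hK9]
    linarith only [this, hP]
  · have : 6 / K ^ 9 ≤ (1 : ℝ) / 10 ^ 9 := by
      rw [div_le_div_iff₀ hK9' (by norm_num)]; nlinarith only [hK9]
    linarith only [this, hP0]

/-! ## §192 The θ-ledger, upper side -/

/-- §192 **THE θ-LEDGER, UPPER SIDE.** `K ≥ 16`, `0 ≤ P₀ ≤ 1/50`, `1 ≤ θ ≤ 3/2`,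
`0 ≤ L ≤ 485K`; `T + θ/s_u ≤ tz < r ≤ T + 2θ/s_l + L/(K¹⁰θ)`, `s_l(r - tz)²/2 < 1`, and
`0 ≤ x ≤ s_u(r - tz)` (part 60's UPPER and CLOCK conclusions with `x = b(r)/ε`). THEN
`x ≤ θ + 529/K⁹` and `x² ≤ 2(1 - P₀) + 42/K⁹`. [derived: this file §192] -/
theorem theta_ledger_upper {K P₀ θ L T tz r x : ℝ} (hK : 16 ≤ K) (hP0 : 0 ≤ P₀)
    (hP : P₀ ≤ 1 / 50) (hθ1 : 1 ≤ θ) (hθ2 : θ ≤ 3 / 2) (hL0 : 0 ≤ L) (hL : L ≤ 485 * K)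
    (htz : T + θ / (1 - P₀ + 6 / K ^ 9) ≤ tz) (htr : tz < r)
    (hr : r ≤ T + 2 * θ / (1 - P₀ - 8 / K ^ 9) + L / (K ^ 10 * θ))
    (hsq : (1 - P₀ - 8 / K ^ 9) * (r - tz) ^ 2 / 2 < 1) (hx0 : 0 ≤ x)
    (hx : x ≤ (1 - P₀ + 6 / K ^ 9) * (r - tz)) :
    x ≤ θ + 529 / K ^ 9 ∧ x ^ 2 ≤ 2 * (1 - P₀) + 42 / K ^ 9 := by
  have hK0 : (0 : ℝ) < K := by linarith
  obtain ⟨hsl, hsu_def, hsu1, hsu2, h14, -, -, -⟩ := ledger_slopes hK hP0 hP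
  obtain ⟨sl, hsl_def⟩ : ∃ sl : ℝ, sl = 1 - P₀ - 8 / K ^ 9 := ⟨_, rfl⟩
  obtain ⟨su, hsu_def'⟩ : ∃ su : ℝ, su = 1 - P₀ + 6 / K ^ 9 := ⟨_, rfl⟩
  obtain ⟨q, hq_def⟩ : ∃ q : ℝ, q = 14 / K ^ 9 := ⟨_, rfl⟩
  simp only [← hsl_def, ← hsu_def', ← hq_def] at hsl hsu_def hsu1 hsu2 h14 htz hr hsq hx
  have hsl0 : 0 < sl := by linarith only [hsl]
  have hsu0 : 0 < su := by linarith only [hsu1]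
  have hθ0 : 0 < θ := by linarith only [hθ1]
  have hK10 : (0 : ℝ) < K ^ 10 := by positivity
  have hq0 : 0 ≤ q := by rw [hq_def]; positivity
  -- r - tz ≤ 2θ/sl + L/(K¹⁰θ) - θ/su
  have hw : r - tz ≤ 2 * θ / sl + L / (K ^ 10 * θ) - θ / su := by linarith only [htz, hr]
  constructor
  · -- x ≤ su(r - tz) ≤ 2θ su/sl - θ + su L/(K¹⁰ θ)
    have h1 : x ≤ su * (2 * θ / sl + L / (K ^ 10 * θ) - θ / su) :=
      hx.trans (mul_le_mul_of_nonneg_left hw hsu0.le)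
    have hne : sl + q ≠ 0 := ne_of_gt (by linarith only [hsl0, hq0])
    have e1 : su * (2 * θ / sl + L / (K ^ 10 * θ) - θ / su)
        = θ + 2 * θ * q / sl + su * L / (K ^ 10 * θ) := by
      rw [hsu_def]; field_simp; ring
    rw [e1] at h1
    -- 2θq/sl ≤ 43/K⁹ and su L/(K¹⁰θ) ≤ 486/K⁹
    have h2 : 2 * θ * q / sl ≤ 43 / K ^ 9 := by
      rw [div_le_iff₀ hsl0, hq_def]
      have : 2 * θ * (14 / K ^ 9) = 28 * θ / K ^ 9 := by ring
      rw [this, div_le_iff₀ (by positivity : (0 : ℝ) < K ^ 9)]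
      have e : 43 / K ^ 9 * sl * K ^ 9 = 43 * sl := by field_simp
      rw [e]; nlinarith only [hθ2, hsl]
    have h3 : su * L / (K ^ 10 * θ) ≤ 486 / K ^ 9 := by
      rw [div_le_iff₀ (by positivity)]
      have e : 486 / K ^ 9 * (K ^ 10 * θ) = 486 * K * θ := by field_simp
      rw [e]
      have : su * L ≤ 100001 / 100000 * (485 * K) :=
        mul_le_mul hsu2 hL hL0 (by norm_num)
      nlinarith only [this, hθ1, hK0]
    have e4 : (43 : ℝ) / K ^ 9 + 486 / K ^ 9 = 529 / K ^ 9 := by ring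
    linarith only [h1, h2, h3, e4]
  · -- x² ≤ su²(r - tz)² < 2 su²/sl ≤ 2(1 - P₀) + 42/K⁹
    have hw0 : 0 ≤ r - tz := by linarith only [htr]
    have h1 : x ^ 2 ≤ su ^ 2 * (r - tz) ^ 2 := by
      rw [← mul_pow]; exact pow_le_pow_left₀ hx0 hx 2
    have h2 : sl * (su ^ 2 * (r - tz) ^ 2) ≤ 2 * su ^ 2 := by nlinarith only [hsq, sq_nonneg su]
    -- `su = sl + q`, `q ≤ 10⁻⁹`: `2su² ≤ sl(2sl + 29q/7)` since `14q ≤ sl`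
    have h3 : 2 * su ^ 2 ≤ sl * (2 * sl + 29 * q / 7) := by
      rw [hsu_def]; nlinarith only [hq0, h14, hsl]
    have h4 : su ^ 2 * (r - tz) ^ 2 ≤ 2 * sl + 29 * q / 7 := by
      by_contra h
      have := mul_lt_mul_of_pos_left (not_le.1 h) hsl0
      linarith only [this, h2, h3]
    have h5 : 2 * sl + 29 * q / 7 = 2 * (1 - P₀) + 42 / K ^ 9 := by
      rw [hsl_def, hq_def]; ring
    linarith only [h1, h4, h5]

/-! ## §193 The θ-ledger, lower side -/

/-- §193 **THE θ-LEDGER, LOWER SIDE.** `K ≥ 16`, `0 ≤ P₀ ≤ 1/50`, `θ ≤ 3/2`;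
`tz ≤ T + θ/s_l`, `tz < r`, part 60's LOWER disjunction
`T + 2θ/s_u < r ∨ 1 - 10 log K/K¹⁰ < s_u(r - tz)²/2` and CLOCK `s_l(r - tz) ≤ x`. THEN
`0 < x` and `θ - 43/K⁹ ≤ x ∨ 2(1 - P₀) - 65/K⁹ ≤ x²`. [derived: this file §193] -/
theorem theta_ledger_lower {K P₀ θ T tz r x : ℝ} (hK : 16 ≤ K) (hP0 : 0 ≤ P₀)
    (hP : P₀ ≤ 1 / 50) (hθ2 : θ ≤ 3 / 2) (htz : tz ≤ T + θ / (1 - P₀ - 8 / K ^ 9))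
    (htr : tz < r)
    (hlow : T + 2 * θ / (1 - P₀ + 6 / K ^ 9) < r ∨
      1 - 10 * log K / K ^ 10 < (1 - P₀ + 6 / K ^ 9) * (r - tz) ^ 2 / 2)
    (hx : (1 - P₀ - 8 / K ^ 9) * (r - tz) ≤ x) :
    0 < x ∧ (θ - 43 / K ^ 9 ≤ x ∨ 2 * (1 - P₀) - 65 / K ^ 9 ≤ x ^ 2) := by
  have hK0 : (0 : ℝ) < K := by linarith
  obtain ⟨hsl, hsu_def, hsu1, hsu2, h14, hlog, hm0, hm1⟩ := ledger_slopes hK hP0 hP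
  obtain ⟨sl, hsl_def⟩ : ∃ sl : ℝ, sl = 1 - P₀ - 8 / K ^ 9 := ⟨_, rfl⟩
  obtain ⟨su, hsu_def'⟩ : ∃ su : ℝ, su = 1 - P₀ + 6 / K ^ 9 := ⟨_, rfl⟩
  obtain ⟨q, hq_def⟩ : ∃ q : ℝ, q = 14 / K ^ 9 := ⟨_, rfl⟩
  obtain ⟨m, hm_def⟩ : ∃ m : ℝ, m = 1 - 10 * log K / K ^ 10 := ⟨_, rfl⟩
  simp only [← hsl_def, ← hsu_def', ← hq_def] at hsl hsu_def hsu1 hsu2 h14 htz hlow hx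
  simp only [← hm_def] at hlow hm0 hm1
  have hsl0 : 0 < sl := by linarith only [hsl]
  have hsu0 : 0 < su := by linarith only [hsu1]
  have hq0 : 0 ≤ q := by rw [hq_def]; positivity
  have hw0 : 0 < r - tz := by linarith only [htr]
  have hx0 : 0 < x := lt_of_lt_of_le (mul_pos hsl0 hw0) hx
  refine ⟨hx0, ?_⟩
  rcases hlow with h | h
  · left
    -- r - tz > 2θ/su - θ/sl, x ≥ sl(r - tz) > θ(2 sl/su - 1) = θ - 2θq/su·… ≥ θ - 43/K⁹
    have hw : 2 * θ / su - θ / sl < r - tz := by linarith only [htz, h]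
    have h1 : sl * (2 * θ / su - θ / sl) < x :=
      lt_of_lt_of_le (mul_lt_mul_of_pos_left hw hsl0) hx
    have hne : sl + q ≠ 0 := ne_of_gt (by linarith only [hsl0, hq0])
    have e1 : sl * (2 * θ / su - θ / sl) = θ - 2 * θ * q / su := by
      rw [hsu_def]; field_simp; ring
    rw [e1] at h1
    have h2 : 2 * θ * q / su ≤ 43 / K ^ 9 := by
      rw [div_le_iff₀ hsu0, hq_def]
      have : 2 * θ * (14 / K ^ 9) = 28 * θ / K ^ 9 := by ring
      rw [this, div_le_iff₀ (by positivity : (0 : ℝ) < K ^ 9)]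
      have e : 43 / K ^ 9 * su * K ^ 9 = 43 * su := by field_simp
      rw [e]; nlinarith only [hθ2, hsu1]
    linarith only [h1, h2]
  · right
    -- (r - tz)² > 2m/su; x² ≥ sl²(r - tz)² > 2 m sl²/su ≥ 2(1 - P₀) - 65/K⁹
    have h1 : (sl * (r - tz)) ^ 2 ≤ x ^ 2 :=
      pow_le_pow_left₀ (mul_nonneg hsl0.le hw0.le) hx 2
    have h2 : 2 * m < su * (r - tz) ^ 2 := by linarith only [h]
    -- multiply by sl²/su: sl² (r-tz)² > 2 m sl²/su
    have h3 : 2 * m * sl ^ 2 < su * (sl * (r - tz)) ^ 2 := by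
      have := mul_lt_mul_of_pos_right h2 (pow_pos hsl0 2)
      nlinarith only [this]
    -- sl² ≥ su (su - 2q) since sl = su - q: sl² = su² - 2 su q + q² ≥ su² - 2 su q
    have h4 : su * (su - 2 * q) ≤ sl ^ 2 := by rw [hsu_def]; nlinarith only [sq_nonneg q]
    have h5 : 2 * m * (su * (su - 2 * q)) ≤ 2 * m * sl ^ 2 :=
      mul_le_mul_of_nonneg_left h4 (by linarith only [hm0])
    have h6 : 2 * m * (su - 2 * q) < (sl * (r - tz)) ^ 2 := by
      have h7 : su * (2 * m * (su - 2 * q)) < su * (sl * (r - tz)) ^ 2 := by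
        nlinarith only [h3, h5]
      exact lt_of_mul_lt_mul_left h7 hsu0.le
    -- 2 m (su - 2q) ≥ 2(su - 2q) - 20 log K/K¹⁰ (su - 2q) ≥ 2 su - 4q - 21/K⁹
    have hK10 : (0 : ℝ) < K ^ 10 := by positivity
    have h8 : 10 * log K / K ^ 10 ≤ 10 / K ^ 9 := by
      rw [div_le_div_iff₀ hK10 (by positivity)]
      have e : (10 : ℝ) * K ^ 10 = 10 * K * K ^ 9 := by ring
      rw [e]
      exact mul_le_mul_of_nonneg_right (by linarith only [hlog]) (by positivity)
    have h9 : 2 * (su - 2 * q) - 2 * (su - 2 * q) * (10 / K ^ 9) ≤ 2 * m * (su - 2 * q) := by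
      rw [hm_def]
      have hsq0 : 0 ≤ su - 2 * q := by linarith only [hsu1, h14, hq0]
      nlinarith only [h8, hsq0]
    have h10 : 2 * (su - 2 * q) * (10 / K ^ 9) ≤ 21 / K ^ 9 := by
      rw [show 2 * (su - 2 * q) * (10 / K ^ 9) = 20 * (su - 2 * q) / K ^ 9 by ring]
      exact div_le_div_of_nonneg_right (by linarith only [hsu2, hq0]) (by positivity)
    have h11 : 2 * su - 4 * q - 21 / K ^ 9 = 2 * (1 - P₀) - 65 / K ^ 9 := by
      rw [hsu_def', hq_def]; ring
    linarith only [h1, h6, h9, h10, h11]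

/-! ## §194 The window step -/

/-- §194 **THE WINDOW STEP OF THE θ-LEDGER.** `K ≥ 16`, `0 ≤ P₀ ≤ 1/50`; the pulse law 2′
(`θₙ - 243/K⁹ ≤ θ' ≤ θₙ + 243/K⁹`, part 61) and the conclusions of §192/§193 at `θ = θ'`
(`x ≤ θ' + 529/K⁹`, `x² ≤ 2(1 - P₀) + 42/K⁹`, `0 < x`,
`θ' - 43/K⁹ ≤ x ∨ 2(1 - P₀) - 65/K⁹ ≤ x²`). THEN `x ≤ 1.41422` and
`θₙ - 286/K⁹ ≤ x ∨ 1.39999 ≤ x`: the next entry ratio re-enters the window with a loss of at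
most `286/K⁹` below, or is clipped to `[1.39999, 1.41422]`. [derived: this file §194] -/
theorem theta_window_step {K P₀ θn θ' x : ℝ} (hK : 16 ≤ K) (hP0 : 0 ≤ P₀) (hP : P₀ ≤ 1 / 50)
    (hlo' : θn - 243 / K ^ 9 ≤ θ') (hx0 : 0 < x)
    (hupp : x ^ 2 ≤ 2 * (1 - P₀) + 42 / K ^ 9)
    (hlow : θ' - 43 / K ^ 9 ≤ x ∨ 2 * (1 - P₀) - 65 / K ^ 9 ≤ x ^ 2) :
    x ≤ 141422 / 100000 ∧ (θn - 286 / K ^ 9 ≤ x ∨ 139999 / 100000 ≤ x) := by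
  have hK9 : (16 : ℝ) ^ 9 ≤ K ^ 9 := pow_le_pow_left₀ (by norm_num) hK 9
  have hK9' : (0 : ℝ) < K ^ 9 := lt_of_lt_of_le (by norm_num) hK9
  have h65 : 65 / K ^ 9 ≤ (1 : ℝ) / 10 ^ 9 := by
    rw [div_le_div_iff₀ hK9' (by norm_num)]; nlinarith only [hK9]
  have h42 : (42 : ℝ) / K ^ 9 ≤ 65 / K ^ 9 := div_le_div_of_nonneg_right (by norm_num) hK9'.le
  constructor
  · have h1 : x ^ 2 ≤ (141422 / 100000 : ℝ) ^ 2 := by nlinarith only [hupp, h42, h65, hP0]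
    exact (abs_le_of_sq_le_sq' h1 (by norm_num)).2
  · rcases hlow with h | h
    · left
      have e : (243 : ℝ) / K ^ 9 + 43 / K ^ 9 = 286 / K ^ 9 := by ring
      linarith only [hlo', h, e]
    · right
      have h1 : (139999 / 100000 : ℝ) ^ 2 ≤ x ^ 2 := by nlinarith only [h, h65, hP]
      by_contra h2
      nlinarith only [h1, hx0, not_le.1 h2]

/-! ## §195 The P-ledger step -/

/-- §195 **THE P-LEDGER STEP.** `0 ≤ P ≤ 1/50`, `0 ≤ η ≤ 0.0171`, `0 ≤ P'` with
`√P' ≤ √P + η` (part 52 §154's pair step over the pulse) and `|P'' - P'| ≤ 6/K⁹` (part 57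
§172's pair dose over the cold phase, `t - T ≤ 3`). THEN `P'' ≤ P + 3η/10 + 6/K⁹`.
[derived: this file §195] -/
theorem pair_ledger_step {K P P' P'' η : ℝ} (hP0 : 0 ≤ P) (hP : P ≤ 1 / 50) (hη0 : 0 ≤ η)
    (hη : η ≤ 171 / 10000) (hP'0 : 0 ≤ P') (hstep : √P' ≤ √P + η)
    (hdose : |P'' - P'| ≤ 6 / K ^ 9) : P'' ≤ P + 3 * η / 10 + 6 / K ^ 9 := by
  have hsP : √P ≤ 1414214 / 10000000 := by
    rw [Real.sqrt_le_left (by norm_num)]; nlinarith only [hP]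
  have hsP0 : 0 ≤ √P := Real.sqrt_nonneg P
  have h1 : P' ≤ (√P + η) ^ 2 := by
    have := pow_le_pow_left₀ (Real.sqrt_nonneg P') hstep 2
    rwa [Real.sq_sqrt hP'0] at this
  have h2 : (√P + η) ^ 2 = P + η * (2 * √P + η) := by
    rw [add_sq, Real.sq_sqrt hP0]; ring
  have h3 : η * (2 * √P + η) ≤ η * (3 / 10) :=
    mul_le_mul_of_nonneg_left (by linarith only [hsP, hη]) hη0
  have h4 := (abs_le.1 hdose).2
  linarith only [h1, h2, h3, h4]

end Summit.NavierStokesRegularity.FluidComputer.GateBudget
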